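import Summits.QuantumFields.YangMills.Theses.ForcedResponseSkewness
import Summits.QuantumFields.YangMills.Theorems.ForcedResponseSkewnessResponseLocalisationDefs
import Summits.QuantumFields.YangMills.Theorems.ForcedResponseSkewnessResponseLocalisationStubSplit
import Summits.QuantumFields.YangMills.Theorems.ForcedResponseSkewnessResponseLocalisationStubShell

/-!
# Birth skeleton (BC3) for the deciding crux `ResponseLocalisation` of route `ForcedResponseSkewness`

ResponseLocalisation ⇐ stub_split   (EXACT BOOKKEEPING: `∂_c Q2(θv,v) − Q3(f,θv,v) = Σ_x (1 − f(s·x))·M(x)` with the response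
                                      profile `M(x) = Σ_{y,z} θv(s y) v(s z) torusK3(x,y,z)`; from tree
                                      `hasDerivAt_torusCov_dens_coupling` + the permutation symmetry of `torusK3`)
                     + stub_contact  (CONTACT CEILING: the response profile has absolute mass ≤ η on sites within physical
                                      distance δ(η) of `supp v ∪ supp θv`, for all large β, large tori, l ∈ [1,Λ] — OPE magnitude ×
                                      a⁸ hyperscaling; no sign, no coefficient value)
                     + stub_far      (FAR-FIELD CEILING: absolute mass ≤ η on sites beyond physical radius D(η) — clustering)
                     + stub_shell    (a Schwartz plateau function: 1 on the shell {δ ≤ dist(·,K), ‖·‖ ≤ D}, values in [0,1],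
                                      vanishing near K and outside 2D; smooth Urysohn, provable now),
with the composition `ResponseLocalisation_of` PROVED here (no sorry outside the four stubs).
Vocabulary (`respM`) and the four stub statements (`SplitSig`, `ContactSig`, `FarSig`, `ShellSig`) live in the tree:
`Theorems/ForcedResponseSkewnessResponseLocalisationDefs.lean` (p589170); stub files import it.  Lead caveats: `Lines/birth.md`.
-/

namespace Summit.QuantumFields.YangMills.Cruxes.ResponseLocalisation.Birth

open MeasureTheory Filter Topology
open Literature.MathematicalPhysics.QuantumFieldTheory Literature.MathematicalPhysics.QuantumLattice
open Literature.MathematicalPhysics.AQFT Literature.Probability.LatticeModels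
open Summit.QuantumFields.YangMills.Cruxes.OSLegsFromFemtoAndGap.DlrCollarTransfer
open Summit.QuantumFields.YangMills.Theses.ForcedResponseSkewness

-- stub_split : SplitSig — LANDED (p589535, Theorems/ForcedResponseSkewnessResponseLocalisationStubSplit.lean), imported.

theorem stub_contact : ContactSig := by
  sorry

theorem stub_far : FarSig := by
  sorry

-- stub_shell : ShellSig — LANDED (p589598, Theorems/ForcedResponseSkewnessResponseLocalisationStubShell.lean), imported.

/-- COMPOSITION (kernel-checked, no sorry): contact ceiling on the δ-collar, far-field ceiling beyond D, the plateau
function in between (where the summand of `stub_split` vanishes identically), thresholds = max. -/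
theorem ResponseLocalisation_of (hsplit : SplitSig) (hcontact : ContactSig) (hfar : FarSig)
    (hshell : ShellSig) : ResponseLocalisation := by
  intro G _ _ _ _ hG
  letI : MeasurableSpace G := borel G
  haveI : BorelSpace G := ⟨rfl⟩
  intro r a v hpos hlim hsupp hfloor η hη Λ hΛ
  obtain ⟨δ, hδ, β₁, Λ₁, hC⟩ := hcontact G hG r a v hpos hlim hsupp hfloor (η / 2) (by positivity) Λ hΛ
  obtain ⟨D₀, hD₀, β₂, Λ₂, hF⟩ := hfar G hG r a v hpos hlim hsupp hfloor (η / 2) (by positivity) Λ hΛ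
  have hδD : δ < max D₀ (2 * δ) := lt_of_lt_of_le (by linarith) (le_max_right _ _)
  obtain ⟨f, hfv, hfθ, hf01, hfone⟩ := hshell v δ (max D₀ (2 * δ)) hδ hδD
  refine ⟨f, hfv, hfθ, max β₁ β₂, max Λ₁ Λ₂, ?_⟩
  intro β hβ L hL l hl
  have hCβ := hC β (le_trans (le_max_left _ _) hβ) L (le_trans (le_max_left _ _) hL) l hl
  have hFβ := hF β (le_trans (le_max_right _ _) hβ) L (le_trans (le_max_right _ _) hL) l hl
  rw [hsplit G hG r β L (l * a β) v f]
  -- pointwise domination of the summand by the contact + far indicators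
  have hpt : ∀ x ∈ box 4 L,
      |(1 - f ((l * a β) • siteToE x)) * respM G r β L (l * a β) v x| ≤
        (if Metric.infDist ((l * a β) • siteToE x) (tsupport v ∪ tsupport (thetaTest 4 v)) < δ then
            |respM G r β L (l * a β) v x| else 0) +
          (if D₀ < ‖(l * a β) • siteToE x‖ then |respM G r β L (l * a β) v x| else 0) := by
    intro x _
    set y := (l * a β) • siteToE x with hy
    set M := respM G r β L (l * a β) v x with hM
    have h01 := hf01 y
    have habs1 : |1 - f y| ≤ 1 := by
      rw [abs_le]; constructor <;> linarith [h01.1, h01.2]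
    rw [abs_mul]
    by_cases h1 : f y = 1
    · rw [h1]; simp only [sub_self, abs_zero, zero_mul]
      positivity
    · -- f y ≠ 1 ⇒ y is in the contact collar or in the far field
      have hcase : Metric.infDist y (tsupport v ∪ tsupport (thetaTest 4 v)) < δ ∨ D₀ < ‖y‖ := by
        by_contra hcon
        rw [not_or, not_lt, not_lt] at hcon
        have hD : ‖y‖ ≤ max D₀ (2 * δ) := le_trans hcon.2 (le_max_left _ _)
        exact h1 (hfone y hcon.1 hD)
      have hMnn : 0 ≤ |M| := abs_nonneg _
      have hle1 : |1 - f y| * |M| ≤ |M| := by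
        calc |1 - f y| * |M| ≤ 1 * |M| := mul_le_mul_of_nonneg_right habs1 hMnn
          _ = |M| := one_mul _
      rcases hcase with hnear | hfar'
      · rw [if_pos hnear]
        have : 0 ≤ (if D₀ < ‖y‖ then |M| else 0) := by split_ifs <;> positivity
        linarith
      · rw [if_pos hfar']
        have : 0 ≤ (if Metric.infDist y (tsupport v ∪ tsupport (thetaTest 4 v)) < δ then |M| else 0) := by
          split_ifs <;> positivity
        linarith
  calc |∑ x ∈ box 4 L, (1 - f ((l * a β) • siteToE x)) * respM G r β L (l * a β) v x|
      ≤ ∑ x ∈ box 4 L, |(1 - f ((l * a β) • siteToE x)) * respM G r β L (l * a β) v x| :=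
        Finset.abs_sum_le_sum_abs _ _
    _ ≤ ∑ x ∈ box 4 L,
          ((if Metric.infDist ((l * a β) • siteToE x) (tsupport v ∪ tsupport (thetaTest 4 v)) < δ then
              |respM G r β L (l * a β) v x| else 0) +
            (if D₀ < ‖(l * a β) • siteToE x‖ then |respM G r β L (l * a β) v x| else 0)) :=
        Finset.sum_le_sum hpt
    _ = (∑ x ∈ box 4 L,
          (if Metric.infDist ((l * a β) • siteToE x) (tsupport v ∪ tsupport (thetaTest 4 v)) < δ then
              |respM G r β L (l * a β) v x| else 0)) +
          ∑ x ∈ box 4 L, (if D₀ < ‖(l * a β) • siteToE x‖ then |respM G r β L (l * a β) v x| else 0) :=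
        Finset.sum_add_distrib
    _ ≤ η / 2 + η / 2 := add_le_add hCβ hFβ
    _ = η := by ring

/-- The crux from the four stubs (sorries live ONLY in the stubs). -/
theorem ResponseLocalisation_holds : ResponseLocalisation :=
  ResponseLocalisation_of stub_split stub_contact stub_far stub_shell

end Summit.QuantumFields.YangMills.Cruxes.ResponseLocalisation.Birth
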